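import Mathlib
import HarnessLib
import Literature.MathematicalPhysics.QuantumLattice.KohnLuttinger
import Literature.MathematicalPhysics.QuantumLattice.KohnLuttingerLindhardMeasurable
import Literature.MathematicalPhysics.QuantumLattice.KohnLuttingerChannelStates
import Summits.HubbardSuperconductivity.HubbardSuperconductivity.Theorems.WeakCouplingBCSWcbcsKohnLuttingerB1gReduction
import Summits.HubbardSuperconductivity.HubbardSuperconductivity.Theorems.WeakCouplingBCSWcbcsKohnLuttingerB1gMuWindow
import Summits.HubbardSuperconductivity.HubbardSuperconductivity.Theorems.ChiralWindowCwKLChiralWindowD4Invariant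
import Summits.HubbardSuperconductivity.HubbardSuperconductivity.Theorems.ChiralWindowCwKLChiralWindowSectorProj
import Summits.HubbardSuperconductivity.HubbardSuperconductivity.Theorems.WeakCouplingBCSDefsKlCertTPrime

/-!
# Route `WeakCouplingBCS` — particle–hole ⊗ `(π, π)` reflection of the Kohn–Luttinger data, I: the shift map
# (located item «(KLSCAN)-TPRIME-PH-REFLECTION», certificate half of stmt-HubbardSuperconductivity-0158; file 1 of 3)

The `t`–`t′` band `ε_{t′} = squareDispersion 1 t′`, `ε_{t′}(k) = -2(cos k₀ + cos k₁) - 4t′ cos k₀ cos k₁`, satisfies the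
particle–hole ⊗ `(π, π)` identity `ε_{t′}(k + (π, π)) = -ε_{-t′}(k)` (`klph_squareDispersion_add_pi_pi`).  The tree's
Kohn–Luttinger objects (`fermiCurve`, `fermiCurveMeasure`, `lindhardFunction`, `channelInf`, `KohnLuttinger.filling` of
`Literature/…/KohnLuttinger.lean`) live on the HALF-OPEN zone `brillouinZone = [-π, π)²` with `D₄` acting about `Γ = 0`,
so the translation by `(π, π)` has to be realised modulo `2πℤ²` ON THE ZONE.  This file defines that realisation and its
elementary properties; files 2 (`…PHReflectionMeasure`) and 3 (`…PHReflection`) transport the Lindhard function, the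
filling, the Fermi-curve measure and the channel states along it and prove
`channelInf ε_{t′} μ U χ = channelInf ε_{-t′} (-μ) U χ`.

* §1 `klphTau` — the half-period swap of `ℝ` (`x ↦ x + π` on `[-π, 0)`, `x ↦ x - π` on `[0, π)`, identity elsewhere):
  a measurable involution preserving Lebesgue measure (`klph_measurePreserving_tau`), `cos ∘ τ = -cos`, `sin ∘ τ = -sin`
  on the period cell, odd off the two half-period endpoints.
* §2 `klphShift` (`T`) — the swap in both coordinates: a measurable, volume-preserving involution of momentum space
  (`klphShiftEquiv : Momentum ≃ᵐ Momentum`), mapping the zone onto itself, with `ε_{t′}(T k) = -ε_{-t′}(k)` on the zone and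
  `T ⁻¹' F(ε_{t′}, μ) = F(ε_{-t′}, -μ)`.
* §3 `klphGood` — the momenta with `0 < |kᵢ| < π`: a `D₄`-invariant subset of the zone on which `T` commutes with the
  `D₄` action `d4Momentum` (`klphShift_d4Momentum`; `D₄` about `M = (π, π)` is `D₄` about `Γ` modulo `2πℤ²`).  Off this
  set (the four lines `kᵢ ∈ {0, -π}`) the commutation fails at isolated boundary points; file 3 shows those lines are null
  for every Fermi-curve measure.

Design: auxiliary `def`s only (swap, shift, its `MeasurableEquiv`, good set); no `instance`/`notation`, no new notion.
References: Raghu–Kivelson–Scalapino, Phys. Rev. B 81 (2010) 224505, §II–III; Šimkovic–Liu–Deng–Kozik, Phys. Rev. B 94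
(2016) 085106, §III.A (the `t′ < 0` phase diagram is the reflection of the `t′ > 0` one about `(t′, n) = (0, 1)`).
-/

noncomputable section

-- the tree's namespace `Summit.<Summit>.<Problem>.Theorems` repeats the summit name by design (D-0017)
set_option linter.dupNamespace false

namespace Summit.HubbardSuperconductivity.HubbardSuperconductivity.Theorems

open MeasureTheory Set Real Literature.MathematicalPhysics.QuantumLattice
open scoped ENNReal

/-! ### §1 The half-period swap of the line -/

/-- The **half-period swap** of the real line: `x ↦ x + π` on `[-π, 0)`, `x ↦ x - π` on `[0, π)`, the
identity outside `[-π, π)`.  On the period cell `[-π, π)` it is the shift by `π` modulo `2π`; it is a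
measurable involution of `ℝ` preserving Lebesgue measure. [folklore] -/
def klphTau (x : ℝ) : ℝ :=
  if x ∈ Ico (-π) 0 then x + π else if x ∈ Ico 0 π then x - π else x

/-- On `[-π, 0)` the swap is `x ↦ x + π`. [folklore] -/
theorem klphTau_of_mem_left {x : ℝ} (hx : x ∈ Ico (-π) 0) : klphTau x = x + π := by
  simp [klphTau, hx]

/-- On `[0, π)` the swap is `x ↦ x - π`. [folklore] -/
theorem klphTau_of_mem_right {x : ℝ} (hx : x ∈ Ico 0 π) : klphTau x = x - π := by
  have h : x ∉ Ico (-π) 0 := fun h => absurd hx.1 (not_le.2 h.2)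
  simp [klphTau, h, hx]

/-- Outside `[-π, π)` the swap is the identity. [folklore] -/
theorem klphTau_of_not_mem {x : ℝ} (hx : x ∉ Ico (-π) π) : klphTau x = x := by
  have h1 : x ∉ Ico (-π) 0 := fun h => hx ⟨h.1, h.2.trans pi_pos⟩
  have h2 : x ∉ Ico 0 π := fun h => hx ⟨by linarith [h.1, pi_pos], h.2⟩
  simp [klphTau, h1, h2]

/-- The swap maps `[-π, 0)` into `[0, π)`. [folklore] -/
theorem klphTau_mem_right_of_mem_left {x : ℝ} (hx : x ∈ Ico (-π) 0) : klphTau x ∈ Ico 0 π := by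
  rw [klphTau_of_mem_left hx]
  exact ⟨by linarith [hx.1], by linarith [hx.2]⟩

/-- The swap maps `[0, π)` into `[-π, 0)`. [folklore] -/
theorem klphTau_mem_left_of_mem_right {x : ℝ} (hx : x ∈ Ico 0 π) : klphTau x ∈ Ico (-π) 0 := by
  rw [klphTau_of_mem_right hx]
  exact ⟨by linarith [hx.1], by linarith [hx.2]⟩

/-- The period cell `[-π, π)` is the disjoint union of its two halves. [folklore] -/
theorem klph_mem_Ico_iff (x : ℝ) : x ∈ Ico (-π) π ↔ x ∈ Ico (-π) 0 ∨ x ∈ Ico 0 π := by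
  constructor
  · intro h
    by_cases h0 : x < 0
    · exact Or.inl ⟨h.1, h0⟩
    · exact Or.inr ⟨not_lt.1 h0, h.2⟩
  · rintro (h | h)
    · exact ⟨h.1, h.2.trans pi_pos⟩
    · exact ⟨by linarith [h.1, pi_pos], h.2⟩

/-- The swap preserves the period cell `[-π, π)`. [folklore] -/
theorem klphTau_mem_Ico {x : ℝ} (hx : x ∈ Ico (-π) π) : klphTau x ∈ Ico (-π) π := by
  rcases (klph_mem_Ico_iff x).1 hx with h | h
  · exact (klph_mem_Ico_iff _).2 (Or.inr (klphTau_mem_right_of_mem_left h))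
  · exact (klph_mem_Ico_iff _).2 (Or.inl (klphTau_mem_left_of_mem_right h))

/-- The swap is an involution. [folklore] -/
theorem klphTau_klphTau (x : ℝ) : klphTau (klphTau x) = x := by
  by_cases hx : x ∈ Ico (-π) π
  · rcases (klph_mem_Ico_iff x).1 hx with h | h
    · rw [klphTau_of_mem_right (klphTau_mem_right_of_mem_left h), klphTau_of_mem_left h]; ring
    · rw [klphTau_of_mem_left (klphTau_mem_left_of_mem_right h), klphTau_of_mem_right h]; ring
  · rw [klphTau_of_not_mem hx, klphTau_of_not_mem hx]

/-- `x ∈ [-π, π) ↔ τ x ∈ [-π, π)`. [folklore] -/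
theorem klphTau_mem_Ico_iff (x : ℝ) : klphTau x ∈ Ico (-π) π ↔ x ∈ Ico (-π) π := by
  refine ⟨fun h => ?_, klphTau_mem_Ico⟩
  by_contra hx
  rw [klphTau_of_not_mem hx] at h
  exact hx h

/-- The swap is Borel measurable. [folklore] -/
theorem klph_measurable_tau : Measurable klphTau := by
  refine Measurable.ite measurableSet_Ico (measurable_id.add_const _) ?_
  exact Measurable.ite measurableSet_Ico (measurable_id.sub_const _) measurable_id

/-- On the period cell the swap is the shift by `π` up to a multiple of `2π`:
`τ x = x + π` or `τ x = x - π`. [folklore] -/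
theorem klphTau_eq_add_pi_or {x : ℝ} (hx : x ∈ Ico (-π) π) :
    klphTau x = x + π ∨ klphTau x = x - π := by
  rcases (klph_mem_Ico_iff x).1 hx with h | h
  · exact Or.inl (klphTau_of_mem_left h)
  · exact Or.inr (klphTau_of_mem_right h)

/-- `cos (τ x) = -cos x` on the period cell. [folklore] -/
theorem cos_klphTau {x : ℝ} (hx : x ∈ Ico (-π) π) : cos (klphTau x) = -cos x := by
  rcases klphTau_eq_add_pi_or hx with h | h
  · rw [h, cos_add_pi]
  · rw [h, cos_sub_pi]

/-- `sin (τ x) = -sin x` on the period cell. [folklore] -/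
theorem sin_klphTau {x : ℝ} (hx : x ∈ Ico (-π) π) : sin (klphTau x) = -sin x := by
  rcases klphTau_eq_add_pi_or hx with h | h
  · rw [h, sin_add_pi]
  · rw [h, sin_sub_pi]

/-- Off the two half-period endpoints `-π, 0` the swap is odd: `τ (-x) = -τ x` for
`x ∈ (-π, 0) ∪ (0, π)`. [folklore] -/
theorem klphTau_neg {x : ℝ} (hx : x ∈ Ico (-π) π) (h0 : x ≠ 0) (hπ : x ≠ -π) :
    klphTau (-x) = -klphTau x := by
  rcases (klph_mem_Ico_iff x).1 hx with h | h
  · have hx' : -x ∈ Ico 0 π := ⟨by linarith [h.2], by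
      rcases lt_or_eq_of_le h.1 with h1 | h1
      · linarith
      · exact absurd h1.symm hπ⟩
    rw [klphTau_of_mem_right hx', klphTau_of_mem_left h]; ring
  · have hx' : -x ∈ Ico (-π) 0 := ⟨by linarith [h.2], by
      rcases lt_or_eq_of_le h.1 with h1 | h1
      · linarith
      · exact absurd h1.symm h0⟩
    rw [klphTau_of_mem_left hx', klphTau_of_mem_right h]; ring

/-- The preimage of a set under the swap, cut with the left half-cell, is a translate:
`τ ⁻¹' s ∩ [-π, 0) = (· + π) ⁻¹' (s ∩ [0, π))`. [folklore] -/
theorem klphTau_preimage_inter_left (s : Set ℝ) :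
    klphTau ⁻¹' s ∩ Ico (-π) 0 = (fun x => x + π) ⁻¹' (s ∩ Ico 0 π) := by
  ext x
  simp only [mem_inter_iff, mem_preimage]
  constructor
  · rintro ⟨hs, hx⟩
    rw [klphTau_of_mem_left hx] at hs
    exact ⟨hs, klphTau_of_mem_left hx ▸ klphTau_mem_right_of_mem_left hx⟩
  · rintro ⟨hs, hx⟩
    have hx' : x ∈ Ico (-π) 0 := ⟨by linarith [hx.1], by linarith [hx.2]⟩
    exact ⟨by rwa [klphTau_of_mem_left hx'], hx'⟩

/-- `(τ ⁻¹' s \ [-π, 0)) ∩ [0, π) = (· + (-π)) ⁻¹' (s ∩ [-π, 0))`. [folklore] -/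
theorem klphTau_preimage_inter_right (s : Set ℝ) :
    (klphTau ⁻¹' s \ Ico (-π) 0) ∩ Ico 0 π = (fun x => x + -π) ⁻¹' (s ∩ Ico (-π) 0) := by
  ext x
  simp only [mem_inter_iff, mem_sdiff, mem_preimage]
  constructor
  · rintro ⟨⟨hs, -⟩, hx⟩
    rw [klphTau_of_mem_right hx, sub_eq_add_neg] at hs
    have := klphTau_mem_left_of_mem_right hx
    rw [klphTau_of_mem_right hx, sub_eq_add_neg] at this
    exact ⟨hs, this⟩
  · rintro ⟨hs, hx⟩
    have hx' : x ∈ Ico 0 π := ⟨by linarith [hx.1], by linarith [hx.2]⟩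
    refine ⟨⟨by rwa [klphTau_of_mem_right hx', sub_eq_add_neg], fun h => absurd hx'.1 (not_le.2 h.2)⟩, hx'⟩

/-- Outside the period cell the preimage is the set itself:
`(τ ⁻¹' s \ [-π, 0)) \ [0, π) = (s \ [-π, 0)) \ [0, π)`. [folklore] -/
theorem klphTau_preimage_diff_diff (s : Set ℝ) :
    (klphTau ⁻¹' s \ Ico (-π) 0) \ Ico 0 π = (s \ Ico (-π) 0) \ Ico 0 π := by
  ext x
  simp only [mem_sdiff, mem_preimage]
  constructor
  · rintro ⟨⟨hs, h1⟩, h2⟩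
    have hx : x ∉ Ico (-π) π := fun h => ((klph_mem_Ico_iff x).1 h).elim h1 h2
    exact ⟨⟨by rwa [klphTau_of_not_mem hx] at hs, h1⟩, h2⟩
  · rintro ⟨⟨hs, h1⟩, h2⟩
    have hx : x ∉ Ico (-π) π := fun h => ((klph_mem_Ico_iff x).1 h).elim h1 h2
    exact ⟨⟨by rwa [klphTau_of_not_mem hx], h1⟩, h2⟩

/-- **The swap preserves Lebesgue measure.** [folklore] -/
theorem klph_measurePreserving_tau : MeasurePreserving klphTau volume volume := by
  refine ⟨klph_measurable_tau, Measure.ext fun s hs => ?_⟩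
  rw [Measure.map_apply klph_measurable_tau hs]
  have hA : MeasurableSet (Ico (-π) (0 : ℝ)) := measurableSet_Ico
  have hB : MeasurableSet (Ico (0 : ℝ) π) := measurableSet_Ico
  rw [← measure_inter_add_sdiff (klphTau ⁻¹' s) hA, ← measure_inter_add_sdiff (klphTau ⁻¹' s \ Ico (-π) 0) hB,
    klphTau_preimage_inter_left, klphTau_preimage_inter_right, klphTau_preimage_diff_diff,
    measure_preimage_add_right, measure_preimage_add_right,
    ← measure_inter_add_sdiff s hA, ← measure_inter_add_sdiff (s \ Ico (-π) 0) hB]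
  have : (s \ Ico (-π) 0) ∩ Ico 0 π = s ∩ Ico 0 π := by
    ext x
    simp only [mem_inter_iff, mem_sdiff]
    constructor
    · rintro ⟨⟨hs, -⟩, hx⟩; exact ⟨hs, hx⟩
    · rintro ⟨hs, hx⟩; exact ⟨⟨hs, fun h => absurd hx.1 (not_le.2 h.2)⟩, hx⟩
  rw [this]
  ring


/-! ### §2 The `(π, π)`-shift of the half-open Brillouin zone -/

/-- The **`(π, π)`-shift of the half-open zone**: the half-period swap in each coordinate.  On
`brillouinZone = [-π, π)²` it is the translation by `(π, π)` modulo `2πℤ²` (a bijection of the zone onto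
itself, piecewise a translation by `(±π, ±π)` on the four quadrants); globally a measurable, Lebesgue-measure
preserving involution of momentum space. [folklore] -/
def klphShift (k : Momentum) : Momentum := WithLp.toLp 2 ![klphTau (k 0), klphTau (k 1)]

/-- Coordinates of the shift: `(T k)₀ = τ k₀`. [folklore] -/
@[simp] theorem klphShift_apply_zero (k : Momentum) : klphShift k 0 = klphTau (k 0) := by
  simp [klphShift]

/-- Coordinates of the shift: `(T k)₁ = τ k₁`. [folklore] -/
@[simp] theorem klphShift_apply_one (k : Momentum) : klphShift k 1 = klphTau (k 1) := by
  simp [klphShift]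

/-- Coordinates of the shift: `(T k)ᵢ = τ kᵢ`. [folklore] -/
theorem klphShift_apply (k : Momentum) (i : Fin 2) : klphShift k i = klphTau (k i) := by
  fin_cases i <;> simp

/-- The shift is an involution. [folklore] -/
theorem klphShift_klphShift (k : Momentum) : klphShift (klphShift k) = k := by
  ext i
  fin_cases i <;> simp [klphTau_klphTau]

/-- The shift is an involution (as a `Function.Involutive`). [folklore] -/
theorem klphShift_involutive : Function.Involutive klphShift := klphShift_klphShift

/-- The shift, factored through the measurable equivalence `Momentum ≃ᵐ (Fin 2 → ℝ)`. [folklore] -/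
theorem klphShift_eq_comp :
    klphShift = (WithLp.toLp 2) ∘ (fun (a : Fin 2 → ℝ) (i : Fin 2) => klphTau (a i)) ∘ (WithLp.ofLp) := by
  funext k
  ext i
  fin_cases i <;> simp [klphShift]

/-- **The shift preserves Lebesgue measure on momentum space.** [folklore] -/
theorem klph_measurePreserving_shift : MeasurePreserving klphShift volume volume := by
  rw [klphShift_eq_comp]
  exact (PiLp.volume_preserving_toLp (Fin 2)).comp
    ((volume_preserving_pi fun _ : Fin 2 => klph_measurePreserving_tau).comp (PiLp.volume_preserving_ofLp (Fin 2)))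

/-- The shift is Borel measurable. [folklore] -/
theorem klph_measurable_shift : Measurable klphShift := klph_measurePreserving_shift.measurable

/-- The shift as a measurable self-equivalence of momentum space. [folklore] -/
def klphShiftEquiv : Momentum ≃ᵐ Momentum :=
  MeasurableEquiv.ofInvolutive klphShift klphShift_involutive klph_measurable_shift

/-- The underlying map of `klphShiftEquiv` is `klphShift`. [folklore] -/
@[simp] theorem coe_klphShiftEquiv : (klphShiftEquiv : Momentum → Momentum) = klphShift := rfl

/-- `T k ∈ BZ ↔ k ∈ BZ`: the shift maps the half-open zone onto itself (and its complement onto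
itself). [folklore] -/
theorem klphShift_mem_brillouinZone_iff (k : Momentum) :
    klphShift k ∈ brillouinZone ↔ k ∈ brillouinZone := by
  simp only [brillouinZone, mem_setOf_eq, klphShift_apply, klphTau_mem_Ico_iff]

/-- `T ⁻¹' BZ = BZ`. [folklore] -/
theorem klphShift_preimage_brillouinZone : klphShift ⁻¹' brillouinZone = brillouinZone :=
  Set.ext klphShift_mem_brillouinZone_iff

/-- The shift preserves Lebesgue measure restricted to the zone. [folklore] -/
theorem klph_measurePreserving_shift_restrict :
    MeasurePreserving klphShift (volume.restrict brillouinZone) (volume.restrict brillouinZone) := by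
  have h := klph_measurePreserving_shift.restrict_preimage measurableSet_brillouinZone
  rwa [klphShift_preimage_brillouinZone] at h

/-- **Particle–hole ⊗ `(π, π)`**: `ε_{t,t′}(k + (π, π)) = -ε_{t,-t′}(k)` for the `t`–`t′` band. [folklore] -/
theorem klph_squareDispersion_add_pi_pi (t tp : ℝ) (k : Momentum) :
    squareDispersion t tp (k + WithLp.toLp 2 ![π, π]) = -squareDispersion t (-tp) k := by
  simp [squareDispersion, cos_add_pi]
  ring

/-- On the zone the shift realises the particle–hole map: `ε_{t′}(T k) = -ε_{-t′}(k)` for `k ∈ BZ`.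
[folklore] -/
theorem klph_squareDispersion_shift (tp : ℝ) {k : Momentum} (hk : k ∈ brillouinZone) :
    squareDispersion 1 tp (klphShift k) = -squareDispersion 1 (-tp) k := by
  simp only [squareDispersion, klphShift_apply_zero, klphShift_apply_one, cos_klphTau (hk 0),
    cos_klphTau (hk 1)]
  ring

/-- The same after a further translation: `ε_{t′}(T p + q) = -ε_{-t′}(p + q)` for `p ∈ BZ` and every `q`.
[folklore] -/
theorem klph_squareDispersion_shift_add (tp : ℝ) {p : Momentum} (hp : p ∈ brillouinZone) (q : Momentum) :
    squareDispersion 1 tp (klphShift p + q) = -squareDispersion 1 (-tp) (p + q) := by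
  have hc : ∀ i : Fin 2, cos (klphTau (p i) + q i) = -cos (p i + q i) := fun i => by
    rcases klphTau_eq_add_pi_or (hp i) with h | h
    · rw [h, show p i + π + q i = (p i + q i) + π by ring, cos_add_pi]
    · rw [h, show p i - π + q i = (p i + q i) - π by ring, cos_sub_pi]
  simp only [squareDispersion, PiLp.add_apply, klphShift_apply_zero, klphShift_apply_one, hc 0, hc 1]
  ring

/-- **The shift maps the Fermi curve of `(-t′, -μ)` onto the Fermi curve of `(t′, μ)`**:
`T ⁻¹' F(ε_{t′}, μ) = F(ε_{-t′}, -μ)`. [folklore] -/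
theorem klphShift_preimage_fermiCurve (tp μ : ℝ) :
    klphShift ⁻¹' fermiCurve (squareDispersion 1 tp) μ = fermiCurve (squareDispersion 1 (-tp)) (-μ) := by
  ext k
  simp only [mem_preimage, mem_fermiCurve_iff, klphShift_mem_brillouinZone_iff]
  constructor
  · rintro ⟨hk, h⟩
    exact ⟨hk, by rw [klph_squareDispersion_shift tp hk] at h; linarith⟩
  · rintro ⟨hk, h⟩
    exact ⟨hk, by rw [klph_squareDispersion_shift tp hk, h, neg_neg]⟩

/-- The shift is a measurable embedding. [folklore] -/
theorem klph_measurableEmbedding_shift : MeasurableEmbedding klphShift :=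
  klphShiftEquiv.measurableEmbedding


/-! ### §3 The good set: where the shift commutes with the point group -/

/-- The **good set** of momenta with no coordinate in `{0, ±π}`: `0 < |kᵢ| < π` for both `i`.  It is
`D₄`-invariant, contained in the zone, of full Fermi-curve measure, and on it the shift `T` commutes
with the action of `D₄`. [folklore] -/
def klphGood : Set Momentum := {k | ∀ i, 0 < |k i| ∧ |k i| < π}

/-- The good set lies in the zone. [folklore] -/
theorem klphGood_subset_brillouinZone : klphGood ⊆ brillouinZone := fun _ hk i =>
  ⟨(abs_lt.1 (hk i).2).1.le, (abs_lt.1 (hk i).2).2⟩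

/-- The good set is invariant under the quarter turn. [folklore] -/
theorem rotMomentum_mem_klphGood_iff (k : Momentum) : rotMomentum k ∈ klphGood ↔ k ∈ klphGood := by
  simp only [klphGood, mem_setOf_eq, Fin.forall_fin_two, rotMomentum_apply_zero, rotMomentum_apply_one,
    abs_neg]
  exact and_comm

/-- The good set is invariant under the reflection. [folklore] -/
theorem reflMomentum_mem_klphGood_iff (k : Momentum) : reflMomentum k ∈ klphGood ↔ k ∈ klphGood := by
  simp only [klphGood, mem_setOf_eq, Fin.forall_fin_two, reflMomentum_apply_zero, reflMomentum_apply_one,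
    abs_neg]

/-- The good set is `D₄`-invariant. [folklore] -/
theorem d4Momentum_mem_klphGood_iff (γ : DihedralGroup 4) (k : Momentum) :
    d4Momentum γ k ∈ klphGood ↔ k ∈ klphGood := by
  rcases kl_sp_d4_cases γ with rfl | rfl | rfl | rfl | rfl | rfl | rfl | rfl <;>
    simp only [d4Momentum_r_zero, d4Momentum_r_one, d4Momentum_r_two, d4Momentum_r_three,
      d4Momentum_sr_zero, d4Momentum_sr_one, d4Momentum_sr_two, d4Momentum_sr_three,
      rotMomentum_mem_klphGood_iff, reflMomentum_mem_klphGood_iff]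

/-- On a good coordinate the swap is odd. [folklore] -/
theorem klphTau_neg_of_abs {x : ℝ} (h0 : 0 < |x|) (hπ : |x| < π) : klphTau (-x) = -klphTau x :=
  klphTau_neg ⟨(abs_lt.1 hπ).1.le, (abs_lt.1 hπ).2⟩ (abs_pos.1 h0)
    (fun h => by rw [h, abs_neg, abs_of_pos pi_pos] at hπ; exact lt_irrefl _ hπ)

/-- On the good set the shift commutes with the quarter turn. [folklore] -/
theorem klphShift_rotMomentum {k : Momentum} (hk : k ∈ klphGood) :
    klphShift (rotMomentum k) = rotMomentum (klphShift k) := by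
  ext i
  fin_cases i <;> simp [rotMomentum, klphTau_neg_of_abs (hk 1).1 (hk 1).2]

/-- On the good set the shift commutes with the reflection. [folklore] -/
theorem klphShift_reflMomentum {k : Momentum} (hk : k ∈ klphGood) :
    klphShift (reflMomentum k) = reflMomentum (klphShift k) := by
  ext i
  fin_cases i <;> simp [reflMomentum, klphTau_neg_of_abs (hk 1).1 (hk 1).2]

/-- **On the good set the shift commutes with the whole point group**: `T (γ k) = γ (T k)` for
`k ∈ klphGood`, `γ ∈ D₄` (`D₄` about `M = (π, π)` is `D₄` about `Γ` modulo `2πℤ²`). [folklore] -/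
theorem klphShift_d4Momentum (γ : DihedralGroup 4) {k : Momentum} (hk : k ∈ klphGood) :
    klphShift (d4Momentum γ k) = d4Momentum γ (klphShift k) := by
  have hr : ∀ {q : Momentum}, q ∈ klphGood → klphShift (rotMomentum q) = rotMomentum (klphShift q) :=
    fun h => klphShift_rotMomentum h
  have hs : ∀ {q : Momentum}, q ∈ klphGood → klphShift (reflMomentum q) = reflMomentum (klphShift q) :=
    fun h => klphShift_reflMomentum h
  have hg : ∀ {q : Momentum}, q ∈ klphGood → rotMomentum q ∈ klphGood :=
    fun h => (rotMomentum_mem_klphGood_iff _).2 h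
  rcases kl_sp_d4_cases γ with rfl | rfl | rfl | rfl | rfl | rfl | rfl | rfl
  · rfl
  · simp only [d4Momentum_r_one, hr hk]
  · simp only [d4Momentum_r_two, hr (hg hk), hr hk]
  · simp only [d4Momentum_r_three, hr (hg (hg hk)), hr (hg hk), hr hk]
  · simp only [d4Momentum_sr_zero, hs hk]
  · simp only [d4Momentum_sr_one, hs (hg hk), hr hk]
  · simp only [d4Momentum_sr_two, hs (hg (hg hk)), hr (hg hk), hr hk]
  · simp only [d4Momentum_sr_three, hs (hg (hg (hg hk))), hr (hg (hg hk)), hr (hg hk), hr hk]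

end Summit.HubbardSuperconductivity.HubbardSuperconductivity.Theorems

end
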